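import Literature.Analysis.FluidPDE.NSSerrinRegularityForced
import Literature.Analysis.FluidPDE.LerayH1ContinuationForced
import Literature.Analysis.FluidPDE.TaoH1AlmostRegularForcedHolds
import HarnessLib

/-!
# T23 («Sohr corner») for Clay-class forces is UNCONDITIONAL: the `_of_tao` theorems of
# `NSSerrinRegularityForced.lean` / `LerayH1ContinuationForced.lean` fed with
# `tao2011_forced_H1_local_almost_regular_holds`

Analysis/FluidPDE proof file (cell `pub/ns-blowup`, seat `ns-blowup-lean`; theorems only, no
definitions, no named facts). lean g7 landed Serrin-class regularity / the Sohr enstrophy bound /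
Ladyzhenskaya–Prodi–Serrin / Leray's `H¹` continuation for Leray–Hopf solutions of the system FORCED
by a Clay-class force, each modulo the ONE named fact `tao2011_forced_H1_local_almost_regular`
(Tao 2013, Thm. 5.4 WITH force, the `H¹` local theory; vendored p428734). That fact is now the tree's
theorem `tao2011_forced_H1_local_almost_regular_holds` (chain «p428734 ⇐ F2»: lit g11 P1/P5,
lean g8 P2, lean2 g4 P3/P4/P6), so the four headline statements hold outright:

* `isH1RegularOn_Ioc_of_serrin_forced`, `exists_eH1NormSq_le_of_serrin_forced`,
  `Sohr2001_serrinClass_enstrophyBound_clay` (Sohr 2001, Thm. V.1.8.2 shape: a.e. enstrophy bound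
  in a Serrin class), `ladyzhenskaya_prodi_serrin_forced` (ns.S07 WITH a Clay-class force),
  `not_tendsto_enstrophy_atTop_of_serrin_forced` (the kill shape: no enstrophy blow-up at `T⁻` in a
  Serrin class), `isH1RegularOn_Ioc_forced` (Leray's `H¹` continuation, forced).

WHAT THIS IS NOT: not a statement about Navier–Stokes blow-up — regularity bookkeeping for forced
WEAK solutions; no flow, stage or blow-up is constructed.

## References

* T. Tao, Anal. PDE 6 (2013) = arXiv:1108.1165, Thm. 5.4, Cor. 11.1. [Tao2011]
* H. Sohr, *The Navier–Stokes Equations. An Elementary Functional Analytic Approach*, Birkhäuser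
  2001, Thm. V.1.8.1–V.1.8.2. [Sohr2001]
* J. Serrin, Arch. Rational Mech. Anal. 9 (1962); O. A. Ladyzhenskaya 1967; G. Prodi 1959.
-/

noncomputable section

open MeasureTheory TopologicalSpace Set Function Filter Topology
open scoped ENNReal NNReal

namespace Literature.Analysis.FluidPDE

section Holds

variable {ν T : ℝ} {f : ℝ → EuclideanSpace ℝ (Fin 3) → EuclideanSpace ℝ (Fin 3)}
  {u₀ : EuclideanSpace ℝ (Fin 3) → EuclideanSpace ℝ (Fin 3)}
  {u : ℝ → EuclideanSpace ℝ (Fin 3) → EuclideanSpace ℝ (Fin 3)}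

/-- **`H¹`-regularity on `(0, T]` in a Serrin class, Clay-class force — unconditional.**
[cite: Tao2011, Thm. 5.4 with Cor. 11.1] -/
theorem isH1RegularOn_Ioc_of_serrin_forced (hν : 0 < ν) (hfs : IsSmoothOnHalfSpace f)
    (hfd : HasRapidSpaceTimeDecay f) (hLH : IsLerayHopfOn T ν f u₀ u) {q r : ℝ≥0∞} (hr : 3 < r)
    (hqr : 2 / q + 3 / r ≤ 1) (hS : MemLqLp q r u (Ioo 0 T)) : IsH1RegularOn (Ioc 0 T) u :=
  isH1RegularOn_Ioc_of_serrin_forced_of_tao tao2011_forced_H1_local_almost_regular_holds hν hfs hfd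
    hLH hr hqr hS

/-- **Uniform `H¹` bound on `(0, T]` in a Serrin class, Clay-class force — unconditional.**
[cite: Tao2011, Thm. 5.4 with Cor. 11.1] -/
theorem exists_eH1NormSq_le_of_serrin_forced (hν : 0 < ν) (hT : 0 < T)
    (hfs : IsSmoothOnHalfSpace f) (hfd : HasRapidSpaceTimeDecay f) (hu₀ : MemLp u₀ 2 volume)
    (hu₀σ : IsWeaklyDivFree u₀) (hu₀grad : eWeakGradL2Sq u₀ < ⊤) (hLH : IsLerayHopfOn T ν f u₀ u)
    {q r : ℝ≥0∞} (hr : 3 < r) (hqr : 2 / q + 3 / r ≤ 1) (hS : MemLqLp q r u (Ioo 0 T)) :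
    ∃ C : ℝ≥0∞, C < ⊤ ∧ ∀ t ∈ Ioc 0 T, eH1NormSq (u t) ≤ C :=
  exists_eH1NormSq_le_of_serrin_forced_of_tao tao2011_forced_H1_local_almost_regular_holds hν hT
    hfs hfd hu₀ hu₀σ hu₀grad hLH hr hqr hS

/-- **Sohr's Serrin-class enstrophy bound WITH a Clay-class force — unconditional** (the conclusion
of the retired unguarded fact `Sohr2001_serrinClass_enstrophyBound_global`, now a theorem for the
cell's force class). [cite: Sohr2001, Thm. V.1.8.2] -/
theorem Sohr2001_serrinClass_enstrophyBound_clay (hν : 0 < ν) (hT : 0 < T)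
    (hfs : IsSmoothOnHalfSpace f) (hfd : HasRapidSpaceTimeDecay f) (hu₀ : MemLp u₀ 2 volume)
    (hu₀σ : IsWeaklyDivFree u₀) (hu₀grad : eWeakGradL2Sq u₀ < ⊤) (hu : IsLerayHopfOn T ν f u₀ u)
    {s q : ℝ≥0∞} (hq : 3 < q) (hsq : 3 / q + 2 / s ≤ 1) (hS : MemLqLp s q u (Ioo 0 T)) :
    ∃ C : ℝ≥0, ∀ᵐ t ∂(volume.restrict (Ioo 0 T)), eWeakGradL2Sq (u t) ≤ C :=
  Sohr2001_serrinClass_enstrophyBound_clay_of_tao tao2011_forced_H1_local_almost_regular_holds hν hT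
    hfs hfd hu₀ hu₀σ hu₀grad hu hq hsq hS

/-- **Ladyzhenskaya–Prodi–Serrin WITH a Clay-class force — unconditional**: a Leray–Hopf solution
in a Serrin class has a classical representative on `(0, T]`. [cite: Tao2011, Thm. 5.4 with Cor. 11.1] -/
theorem ladyzhenskaya_prodi_serrin_forced (hν : 0 < ν) (hfs : IsSmoothOnHalfSpace f)
    (hfd : HasRapidSpaceTimeDecay f) (hLH : IsLerayHopfOn T ν f u₀ u) {q r : ℝ≥0∞} (hr : 3 < r)
    (hqr : 2 / q + 3 / r ≤ 1) (hS : MemLqLp q r u (Ioo 0 T)) :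
    ∃ (v : ℝ → EuclideanSpace ℝ (Fin 3) → EuclideanSpace ℝ (Fin 3))
      (p : ℝ → EuclideanSpace ℝ (Fin 3) → ℝ),
      IsClassicalNSSolutionOn (Ioc 0 T) ν f v p ∧ ∀ t ∈ Ioc 0 T, u t =ᵐ[volume] v t :=
  ladyzhenskaya_prodi_serrin_forced_of_tao tao2011_forced_H1_local_almost_regular_holds hν hfs hfd
    hLH hr hqr hS

/-- **The kill shape: no enstrophy blow-up at `T⁻` in a Serrin class, Clay-class force —
unconditional.** [cite: Sohr2001, Thm. V.1.8.2] -/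
theorem not_tendsto_enstrophy_atTop_of_serrin_forced (hν : 0 < ν) (hT : 0 < T)
    (hfs : IsSmoothOnHalfSpace f) (hfd : HasRapidSpaceTimeDecay f) (hu₀ : MemLp u₀ 2 volume)
    (hu₀σ : IsWeaklyDivFree u₀) (hu₀grad : eWeakGradL2Sq u₀ < ⊤) (hu : IsLerayHopfOn T ν f u₀ u)
    {s q : ℝ≥0∞} (hq : 3 < q) (hsq : 3 / q + 2 / s ≤ 1) (hS : MemLqLp s q u (Ioo 0 T)) :
    ¬ Tendsto (fun t => eWeakGradL2Sq (u t)) (𝓝[<] T) atTop :=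
  not_tendsto_enstrophy_atTop_of_serrin_forced_of_tao tao2011_forced_H1_local_almost_regular_holds
    hν hT hfs hfd hu₀ hu₀σ hu₀grad hu hq hsq hS

/-- **Leray's `H¹` continuation WITH a Clay-class force — unconditional.**
[cite: Tao2011, Thm. 5.4] -/
theorem isH1RegularOn_Ioc_forced (hν : 0 < ν) (hfs : IsSmoothOnHalfSpace f)
    (hfd : HasRapidSpaceTimeDecay f) (hLH : IsLerayHopfOn T ν f u₀ u)
    (hhyp : ∀ α β : ℝ, 0 ≤ α → α < β → β ≤ T → IsH1RegularOn (Ioo α β) u →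
      limsup (fun t => eH1NormSq (u t)) (𝓝[<] β) < ∞) :
    IsH1RegularOn (Ioc 0 T) u :=
  isH1RegularOn_Ioc_forced_of_tao tao2011_forced_H1_local_almost_regular_holds hν hfs hfd hLH hhyp

end Holds

end Literature.Analysis.FluidPDE

end
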